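import Literature.Analysis.ValidatedNumerics.TaylorModelExp
import HarnessLib

/-!
# Taylor models of `φ(u) = (1 − e^{-u})/u` on a large range

Trunk T-ANA (Analysis/ValidatedNumerics); namespace `Literature.Analysis.ValidatedNumerics.PolyMP`.
Sequel of `TaylorModelExp.lean`, whose `tmem_phi` uses the exponential remainder `Real.exp_bound` and is
therefore limited to `|u| ≤ 1`.  With the factorially damped remainder `|e^x − Σ_{m<n} x^m/m!| ≤ 2|x|^n/n!`
for `|x| ≤ (n+1)/2` (`Complex.exp_bound'`, here `Real.abs_exp_sub_sum_le`) the same construction works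
on `|u| ≤ (K+2)/2`, i.e. on every bounded range once the number of terms `K` is large: `tphiLI`,
`tmem_phiL`.  Use: the regularised archimedean density `tρ(t) = e^{-t/2}/(2φ(2t))` of Weil's explicit
formula on windows `2t ≤ 3`.  Problem-independent; no facts, no axioms.

## References

* The exponential series with remainder (Mathlib `Complex.exp_bound'`). [folklore]
* K. Makino, M. Berz, Int. J. Pure Appl. Math. 4 (2003) 379–456, §2. [folklore]
-/

namespace Real

open Finset in
/-- `|e^x − Σ_{m<n} x^m/m!| ≤ 2|x|^n/n!` whenever `|x| ≤ (n+1)/2` (real form of `Complex.exp_bound'`).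
[folklore] -/
theorem abs_exp_sub_sum_le {x : ℝ} {n : ℕ} (hx : |x| / (n.succ : ℝ) ≤ 1 / 2) :
    |Real.exp x - ∑ m ∈ range n, x ^ m / m.factorial| ≤ |x| ^ n / n.factorial * 2 := by
  have hxc : ‖(x : ℂ)‖ / (n.succ : ℝ) ≤ 1 / 2 := by rwa [Complex.norm_real, Real.norm_eq_abs]
  convert Complex.exp_bound' hxc using 1 <;> norm_cast

end Real

namespace Literature.Analysis.ValidatedNumerics

namespace PolyMP

open Literature.Analysis.ValidatedNumerics.NumericsMP
open Literature.Analysis.ValidatedNumerics.ExpPoly (Poly)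

/-- **Taylor expansion of `φ` with the damped remainder**: for `0 < K` and `|u| ≤ (K+2)/2`,
`|φ(u) − Σ_{k<K} (−u)^k/(k+1)!| ≤ 2|u|^K/(K+1)!`. [folklore] -/
theorem abs_phiExp_sub_le' {u : ℝ} {K : ℕ} (hK : 0 < K) (hu : |u| / ((K + 1 : ℕ).succ : ℝ) ≤ 1 / 2) :
    |phiExp u - Poly.eval (phiCoeffs K) u| ≤ |u| ^ K / (((K + 1).factorial : ℕ) : ℝ) * 2 := by
  rw [phiCoeffs, poly_eval_map_range]
  by_cases h0 : u = 0
  · subst h0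
    have : ∑ k ∈ Finset.range K, (((-1 : ℚ) ^ k / ((k + 1).factorial : ℚ) : ℚ) : ℝ) * (0 : ℝ) ^ k = 1 := by
      rw [Finset.sum_eq_single 0]
      · simp
      · intro k _ hk; simp [hk]
      · intro h; exact absurd (Finset.mem_range.2 hK) h
    rw [phiExp, if_pos rfl, this]
    simp [zero_pow hK.ne']
  · have hx : |(-u)| / ((K + 1 : ℕ).succ : ℝ) ≤ 1 / 2 := by rwa [abs_neg]
    have hrem := Real.abs_exp_sub_sum_le hx
    rw [Finset.sum_range_succ'] at hrem
    simp only [pow_zero, Nat.factorial_zero, Nat.cast_one, div_one] at hrem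
    have hphi : phiExp u = (1 - Real.exp (-u)) / u := by rw [phiExp, if_neg h0]
    have hsum : ∑ k ∈ Finset.range K, (((-1 : ℚ) ^ k / ((k + 1).factorial : ℚ) : ℚ) : ℝ) * u ^ k =
        -(∑ k ∈ Finset.range K, (-u) ^ (k + 1) / ((k + 1).factorial : ℝ)) / u := by
      rw [← Finset.sum_neg_distrib, Finset.sum_div]
      refine Finset.sum_congr rfl fun k _ => ?_
      push_cast
      rw [neg_pow, pow_succ]
      field_simp
      ring
    have hkey : phiExp u - ∑ k ∈ Finset.range K, (((-1 : ℚ) ^ k / ((k + 1).factorial : ℚ) : ℚ) : ℝ) * u ^ k =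
        -(Real.exp (-u) - (∑ k ∈ Finset.range K, (-u) ^ (k + 1) / ((k + 1).factorial : ℝ) + 1)) / u := by
      rw [hphi, hsum]; field_simp; ring
    rw [hkey, abs_div, abs_neg]
    have hupos : 0 < |u| := abs_pos.2 h0
    rw [div_le_iff₀ hupos]
    refine hrem.trans (le_of_eq ?_)
    simp only [abs_neg, pow_succ]
    ring

/-- Scaled Taylor coefficients `(−λ)^k/(k+1)!`: `φ(u) = Σ_k ((−λ)^k/(k+1)!) (u/λ)^k`.  Evaluating the series by
Horner in `u/λ` with `|u| ≤ λ` avoids the growth `|u|^K` of interval widths (interval Horner at `|u| > 1`).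
[folklore] -/
def phiCoeffsScaled (K lam : ℕ) : List ℚ := (List.range K).map fun k => (-(lam : ℚ)) ^ k / ((k + 1).factorial : ℚ)

/-- [folklore] -/
theorem eval_phiCoeffsScaled (K : ℕ) {lam : ℕ} (hlam : 0 < lam) (u : ℝ) :
    Poly.eval (phiCoeffsScaled K lam) (u / lam) = Poly.eval (phiCoeffs K) u := by
  rw [phiCoeffsScaled, phiCoeffs, poly_eval_map_range, poly_eval_map_range]
  refine Finset.sum_congr rfl fun k _ => ?_
  have hl : (lam : ℝ) ≠ 0 := by exact_mod_cast hlam.ne'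
  push_cast
  have e : ((lam : ℝ)) ^ k * (u / lam) ^ k = u ^ k := by
    rw [← mul_pow]; congr 1; field_simp
  rw [neg_pow (lam : ℝ)]
  calc (-1 : ℝ) ^ k * (lam : ℝ) ^ k / (((k + 1).factorial : ℕ) : ℝ) * (u / lam) ^ k
      = (-1 : ℝ) ^ k / (((k + 1).factorial : ℕ) : ℝ) * ((lam : ℝ) ^ k * (u / lam) ^ k) := by ring
    _ = (-1 : ℝ) ^ k / (((k + 1).factorial : ℕ) : ℝ) * u ^ k := by rw [e]

/-- Scaled damped remainder bound `⌈S · 2 (B/S)^K/(K+1)!⌉` from a scaled range bound `B` of `u`. [folklore] -/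
def tphiLRem (S : ℕ) (B : ℤ) (K : ℕ) : ℤ :=
  ⌈(S : ℚ) * (((B : ℚ) / S) ^ K / (((K + 1).factorial : ℕ) : ℚ) * 2)⌉

/-- The large-range Taylor model of `ρ ↦ φ(u(ρ))`: Horner in `u/λ` on the scaled coefficients, plus the
remainder. [folklore] -/
def tphiLI (S : ℕ) (h : ℚ) (D K lam : ℕ) (U : IPoly) : IPoly :=
  widen0 (thornerI S h D (phiCoeffsScaled K lam) (tdivNat lam U)) (tphiLRem S (tabsI S h U) K)

/-- Range condition `|u| ≤ (K+2)/2` from the scaled bound: `2 · tabsI ≤ S (K+2)`. [folklore] -/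
def tphiLCheck (S : ℕ) (h : ℚ) (K : ℕ) (U : IPoly) : Bool :=
  decide (2 * tabsI S h U ≤ (S : ℤ) * (K + 2))

/-- **Soundness of `tphiLI`.** If `U` encloses `u` on `|ρ| ≤ h`, `0 < K`, `0 < λ`, and `tphiLCheck` accepts
(`|u| ≤ (K+2)/2` on the panel), then `tphiLI S h D K λ U` encloses `ρ ↦ φ(u(ρ))`. [folklore] -/
theorem tmem_phiL {S : ℕ} (hS : 0 < S) {h : ℚ} (h0 : 0 ≤ h) (D : ℕ) {K : ℕ} (hK : 0 < K) {lam : ℕ}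
    (hlam : 0 < lam) {u : ℝ → ℝ} {U : IPoly} (hu : TMem S h u U) (hchk : tphiLCheck S h K U = true) :
    TMem S h (fun ρ => phiExp (u ρ)) (tphiLI S h D K lam U) := by
  unfold tphiLCheck at hchk
  have hB : 2 * tabsI S h U ≤ (S : ℤ) * (K + 2) := of_decide_eq_true hchk
  intro ρ hρ
  obtain ⟨as, has, hev⟩ := tmem_horner hS h0 D (tmem_divNat hlam hu) (phiCoeffsScaled K lam) ρ hρ
  simp only [] at hev
  rw [eval_phiCoeffsScaled K hlam] at hev
  have hSr : (0 : ℝ) < S := by exact_mod_cast hS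
  have habs := abs_le_tabsI h0 hu hρ
  have huB : |u ρ| ≤ (tabsI S h U : ℝ) / S := by rw [le_div_iff₀ hSr]; exact habs
  have hBr : 2 * (tabsI S h U : ℝ) ≤ (S : ℝ) * (K + 2) := by exact_mod_cast hB
  have hu1 : |u ρ| / ((K + 1 : ℕ).succ : ℝ) ≤ 1 / 2 := by
    rw [div_le_iff₀ (by positivity)]
    push_cast
    have : |u ρ| * S * 2 ≤ (S : ℝ) * (K + 2) := by nlinarith
    nlinarith
  set δ : ℝ := phiExp (u ρ) - Poly.eval (phiCoeffs K) (u ρ) with hδ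
  have hδle : |δ| * S ≤ (tphiLRem S (tabsI S h U) K : ℝ) := by
    have h1 := abs_phiExp_sub_le' hK hu1
    have h2 : |u ρ| ^ K ≤ ((tabsI S h U : ℝ) / S) ^ K := pow_le_pow_left₀ (abs_nonneg _) huB K
    have hc : (0 : ℝ) ≤ 1 / (((K + 1).factorial : ℕ) : ℝ) * 2 := by positivity
    have h3 : |δ| ≤ ((tabsI S h U : ℝ) / S) ^ K / (((K + 1).factorial : ℕ) : ℝ) * 2 := by
      refine h1.trans ?_
      have := mul_le_mul_of_nonneg_right h2 hc
      simpa [div_eq_mul_inv, mul_assoc] using this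
    have h4 : ((S : ℚ) * ((((tabsI S h U : ℤ) : ℚ) / S) ^ K / (((K + 1).factorial : ℕ) : ℚ) * 2) : ℝ) ≤
        (tphiLRem S (tabsI S h U) K : ℝ) := by
      unfold tphiLRem; exact_mod_cast Int.le_ceil _
    refine le_trans ?_ h4
    push_cast
    nlinarith [h3, abs_nonneg δ, hSr.le]
  obtain ⟨bs, hbs, hev2⟩ := exists_widen0 has hδle ρ
  exact ⟨bs, hbs, by rw [hev2, ← hev, hδ]; ring⟩

end PolyMP

end Literature.Analysis.ValidatedNumerics
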